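import Summits.Ventures.DiscreteObjects.PP12.FanoUnique
import Summits.Ventures.DiscreteObjects.PP12.OrderElevenIff

/-!
# PP(12), order-5 cell: the census target is ONE finite statement about the standard Fano labelling (kernel; bookkeeping)
Framing: lottery ticket; floor = certified bounds/negative ranges.

Cell pub-namedobj (venture DiscreteObjects), target (M), designs gen 16. With `FanoUnique.noFanoFiveIncMatrix_iff_std` the order-5 hypothesis of the
rigid endgame becomes the one-labelling statement `NoFanoFiveIncMatrixStd := ∀ M, ¬ IsFanoFiveIncMatrix FanoFive.stdI M` — a single finite system
(`30 × 30` matrix over `ℕ`, entries `≤ 2` by `FanoFiveFinite`) that an engine decides literally: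
* `noOrderFive_of_std : (∀ M, ¬ IsFanoFiveIncMatrix stdI M) → NoOrderFiveOrder12`;
* `twoThreeGroup_of_std_arrays` and **`card_collineationGroup_eq_one_v14`** — the rigid endgame with the order-5 hypothesis in one-labelling form
  (all nine hypotheses literal finite statements: `NoLiftableSTD2_12_6`, `NoLiftableSTD3_12_4`, `NoFlagOrbitMatrix 4`, `NoFlagOrbitMatrix 3`,
  `NoFlagSevenOrbitMatrix`, `NoFlagTenOrbitMatrix`, `∀ M, ¬ IsFanoFiveIncMatrix stdI M`, `NoCollineationOfOrderEleven`, `NoLiftData13`).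
Census status unchanged (the `stdI` system is designs g10's model up to the derivation of their signs/Gram form — HANDOFF item; EMPTY there, outside
the kernel; in print JvT 1982). Nothing here asserts any hypothesis. No `sorry`, no new axioms.
-/

namespace Summit.Ventures.DiscreteObjects.PP12

/-- **The order-5 cell from the one-labelling statement.** -/
theorem noOrderFive_of_std (h5 : ∀ M : F5Idx → F5Idx → ℕ, ¬ IsFanoFiveIncMatrix FanoFive.stdI M) : NoOrderFiveOrder12 :=
  noOrderFive_of_noFanoFiveIncMatrix (noFanoFiveIncMatrix_iff_std.2 h5)

open Literature.Combinatorics.Designs in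
/-- **Janko–van Trung's `{2,3}`-group theorem from three literal finite statements.** -/
theorem twoThreeGroup_of_std_arrays (h5 : ∀ M : F5Idx → F5Idx → ℕ, ¬ IsFanoFiveIncMatrix FanoFive.stdI M)
    (h11 : NoCollineationOfOrderEleven) (h13 : NoLiftData13) : CollineationGroupIsTwoThreeGroup :=
  twoThreeGroup_iff_arrays.2 ⟨noOrderFive_of_std h5, h11, h13⟩

open Literature.Combinatorics.Designs Summit.Ventures.DiscreteObjects.STD in
/-- **Rigid endgame, v14 (all hypotheses literal finite statements, order 5 in one-labelling form).** -/
theorem card_collineationGroup_eq_one_v14 (h2 : NoLiftableSTD2_12_6) (h3E : NoLiftableSTD3_12_4)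
    (h4 : NoFlagOrbitMatrix 4) (h3 : NoFlagOrbitMatrix 3) (h7 : NoFlagSevenOrbitMatrix) (h10 : NoFlagTenOrbitMatrix)
    (h5 : ∀ M : F5Idx → F5Idx → ℕ, ¬ IsFanoFiveIncMatrix FanoFive.stdI M) (h11 : NoCollineationOfOrderEleven) (h13 : NoLiftData13)
    (P L : Type) [Membership P L] [Fintype P] [Fintype L] [Configuration.ProjectivePlane P L] (h12 : Configuration.ProjectivePlane.order P L = 12)
    (G : Type) [Group G] [Fintype G] [MulAction G P] [MulAction G L] (hG : IsCollineationGroup G P L) :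
    Fintype.card G = 1 :=
  card_collineationGroup_eq_one_v13 h2 h3E h4 h3 h7 h10 (noFanoFiveIncMatrix_iff_std.2 h5) h11 h13 P L h12 G hG

end Summit.Ventures.DiscreteObjects.PP12
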